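import Mathlib
import HarnessLib
import Summits.ValiantsHypothesis.ValiantsHypothesis.Theorems.LacunarySymmetroidMatrixDescartesOsculationLawUniformGcdRow
import Summits.ValiantsHypothesis.ValiantsHypothesis.Theorems.LacunarySymmetroidMatrixDescartesOsculationLawUniformPosRoot
import Summits.ValiantsHypothesis.ValiantsHypothesis.Theorems.LacunarySymmetroidMatrixDescartesOsculationLawUniformSubresultantSupport
import Summits.ValiantsHypothesis.ValiantsHypothesis.Theorems.LacunarySymmetroidMatrixDescartesOsculationLawCuspNonMonicCount

/-!
# ValiantsHypothesis / LacunarySymmetroid — crux `MatrixDescartes` (stmt-ValiantsHypothesis-18050, V1),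
# line «osculation-law»: UNIFORM columns, part 4 — the COUNT: finitely many common positive zeros of two isobaric
# bivariate fewnomials, one of them hyperbolic, lie over the positive roots of ONE sparse polynomial

Abstract form of every osculation-law column at once.  Data: `P, Q ∈ ℝ[t][b]` with ISOBARIC fewnomial
coefficients (`supp_t P_j ⊆ (α − j) • E`, `supp_t Q_j ⊆ (β − j) • E`), `P(t,·)` real-rooted for every `t > 0`
(the hyperbolic letter), `P(t,·) ≡ 0 ⇒ Q(t,·) ≡ 0` (vertical rays), and a FINITE set
`osc = {(t,b) : t > 0, b > 0, P(t,b) = 0, Q(t,b) = 0}`.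

* `abscissa_isRoot` (the open-arc argument): given a «gcd row» `ρ_t = N(t,·)/D(t)` — monic, dividing `P(t,·)`,
  catching the common roots and only roots of `Q(t,·)` — valid wherever a polynomial `Pex(t) ≠ 0`, every abscissa of
  `osc` is a root of `Pex`.  (At an abscissa `t₀` with `Pex(t₀) ≠ 0`, `ρ_{t₀}` has a positive root, hence a negative
  coefficient (`exists_coeff_neg_of_pos_root`); the coefficient `N_i(t)/D(t)` stays negative nearby, `ρ_t` stays
  real-rooted (a divisor of `P(t,·)`), so it keeps a positive root (`exists_pos_root_of_coeff_neg`) — an open arc of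
  osculation points, contradicting finiteness.)
* `ncard_le_of_abscissa_isRoot`: then `#osc ≤ deg_b P · |supp Pex|` (fibres are roots of `P(t,·) ≢ 0`, abscissae are
  positive roots of `Pex`, Descartes `card_roots_filter_pos_le_card_support`).
* `uniform_count`: with the gcd row of `OsculationUniform.gcd_row` (subresultants, part 1) and
  `Pex = lc P · lc Q · σ_{k*}`, isobaric of weight `≤ (α+β)² + (α+β)` (part 3):
  `#osc ≤ α · |E| ^ ((α+β)² + (α+β))`.

Honest framing: helper theorem toward a UNIFORM Descartes ceiling for the osculation-law columns of an UNREGISTERED V1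
law line (every `(r,s)` at once); it is NOT the line's `stub_osculationLaw` (`2^(C(K+log² m))`), and `PeelInequality`,
`MatrixDescartes`, Conjecture B, `VP ≠ VNP` are OPEN / NOT proved.  No definitions, no named facts; Mathlib + tree files.
-/

-- `Summit.ValiantsHypothesis.ValiantsHypothesis.…` is the tree's mandated single-conjunct layout (Sub = Summit).
set_option linter.dupNamespace false

noncomputable section

namespace Summit.ValiantsHypothesis.ValiantsHypothesis.Theorems.LacunarySymmetroidMatrixDescartes

namespace OsculationUniform

open Polynomial Set
open scoped BigOperators Pointwise
open Literature.Algebra.Polynomial Literature.Algebra.Polynomial.Subresultant Literature.Algebra.Polynomial.ModularEEA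

/-! ### Small facts -/

/-- `Fin 2` vectors are `![p 0, p 1]`. [folklore] -/
theorem vec2_eq (p : Fin 2 → ℝ) : (![p 0, p 1] : Fin 2 → ℝ) = p := by
  ext i; fin_cases i <;> rfl

/-- Sign of `d⁻¹ x` is the sign of `d x`. [folklore] -/
theorem inv_mul_neg_iff {d x : ℝ} (hd : d ≠ 0) : d⁻¹ * x < 0 ↔ d * x < 0 := by
  have hd2 : 0 < d * d := mul_self_pos.2 hd
  have e : d * x = (d * d) * (d⁻¹ * x) := by field_simp
  constructor
  · intro h; rw [e]; exact mul_neg_of_pos_of_neg hd2 h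
  · intro h
    by_contra hcon
    have : 0 ≤ d * x := by rw [e]; exact mul_nonneg hd2.le (not_lt.1 hcon)
    linarith

/-- A specialisation with surviving leading coefficient is nonzero. [folklore] -/
theorem map_ne_zero_of_eval_leadingCoeff {P : ℝ[X][X]} {t : ℝ} (h : P.leadingCoeff.eval t ≠ 0) :
    P.map (evalRingHom t) ≠ 0 := fun h0 => h (by
  have := congr_arg (fun q => q.coeff P.natDegree) h0
  simp only [coeff_map, coeff_zero, coe_evalRingHom] at this
  exact this)

/-! ### The open-arc argument -/

/-- **Abscissae of a finite osculation-type set are roots of `Pex`.**  See the module docstring. [folklore] -/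
theorem abscissa_isRoot (P Q : ℝ[X][X]) (osc : Set (Fin 2 → ℝ))
    (hosc : ∀ p : Fin 2 → ℝ, p ∈ osc ↔ 0 < p 0 ∧ 0 < p 1 ∧ (P.map (evalRingHom (p 0))).IsRoot (p 1) ∧
      (Q.map (evalRingHom (p 0))).IsRoot (p 1))
    (hfin : osc.Finite) (hsplit : ∀ t : ℝ, 0 < t → (P.map (evalRingHom t)).Splits)
    (N : ℝ[X][X]) (D Pex : ℝ[X])
    (hP : ∀ t : ℝ, 0 < t → Pex.eval t ≠ 0 → P.map (evalRingHom t) ≠ 0)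
    (hrow : ∀ t : ℝ, 0 < t → Pex.eval t ≠ 0 →
      D.eval t ≠ 0 ∧ (C (D.eval t)⁻¹ * N.map (evalRingHom t)).Monic ∧
        C (D.eval t)⁻¹ * N.map (evalRingHom t) ∣ P.map (evalRingHom t) ∧
        (∀ β : ℝ, (P.map (evalRingHom t)).IsRoot β → (Q.map (evalRingHom t)).IsRoot β →
          (C (D.eval t)⁻¹ * N.map (evalRingHom t)).IsRoot β) ∧
        (∀ β : ℝ, (C (D.eval t)⁻¹ * N.map (evalRingHom t)).IsRoot β → (Q.map (evalRingHom t)).IsRoot β)) :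
    ∀ p ∈ osc, Pex.IsRoot (p 0) := by
  intro p₀ hp₀
  by_contra hPex0
  obtain ⟨ht₀, hb₀, hP₀, hQ₀⟩ := (hosc p₀).1 hp₀
  obtain ⟨hD₀, hmon₀, -, hcommon₀, -⟩ := hrow (p₀ 0) ht₀ hPex0
  -- a negative coefficient of the gcd row at `t₀`
  obtain ⟨i, hi⟩ := exists_coeff_neg_of_pos_root _ hmon₀ hb₀ (hcommon₀ _ hP₀ hQ₀)
  have hcoeff : ∀ t : ℝ, (C (D.eval t)⁻¹ * N.map (evalRingHom t)).coeff i = (D.eval t)⁻¹ * (N.coeff i).eval t := by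
    intro t; rw [coeff_C_mul, coeff_map, coe_evalRingHom]
  rw [hcoeff, inv_mul_neg_iff hD₀] at hi
  -- the open set of good abscissae where that coefficient is negative
  set W : Set ℝ := {t : ℝ | 0 < t} ∩ ({t : ℝ | Pex.eval t ≠ 0} ∩ {t : ℝ | (D * N.coeff i).eval t < 0}) with hW
  have hWopen : IsOpen W :=
    (isOpen_lt continuous_const continuous_id).inter
      ((isOpen_ne_fun Pex.continuous continuous_const).inter (isOpen_lt (D * N.coeff i).continuous continuous_const))
  have ht₀W : p₀ 0 ∈ W := ⟨ht₀, hPex0, by show (D * N.coeff i).eval (p₀ 0) < 0; rw [eval_mul]; exact hi⟩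
  -- over `W` every abscissa carries an osculation point
  have hmem : ∀ t ∈ W, ∃ b : ℝ, 0 < b ∧ (![t, b] : Fin 2 → ℝ) ∈ osc := by
    rintro t ⟨ht, hPext, hneg⟩
    obtain ⟨hDt, hmon, hdvd, -, hQroot⟩ := hrow t ht hPext
    have hsp : (C (D.eval t)⁻¹ * N.map (evalRingHom t)).Splits :=
      (hsplit t ht).of_dvd (hP t ht hPext) hdvd
    have hci : (C (D.eval t)⁻¹ * N.map (evalRingHom t)).coeff i < 0 := by
      rw [hcoeff, inv_mul_neg_iff hDt, ← eval_mul]; exact hneg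
    obtain ⟨b, hb, hroot⟩ := exists_pos_root_of_coeff_neg _ hmon hsp hci
    refine ⟨b, hb, (hosc _).2 ⟨?_, ?_, ?_, ?_⟩⟩
    · simpa using ht
    · simpa using hb
    · simp only [Matrix.cons_val_zero, Matrix.cons_val_one]
      exact hroot.dvd hdvd
    · simp only [Matrix.cons_val_zero, Matrix.cons_val_one]
      exact hQroot b hroot
  choose! γ hγpos hγmem using hmem
  exact hfin.not_infinite (OsculationCusp.infinite_of_curve hWopen ht₀W γ fun t ht => hγmem t ht)

/-! ### Counting over the roots of `Pex` -/

/-- **Fibre count.**  If every abscissa of `osc` is a root of `Pex ≢ 0` and no fibre is a vertical ray, then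
`#osc ≤ deg_b P · |supp Pex|`. [folklore] -/
theorem ncard_le_of_abscissa_isRoot (P Q : ℝ[X][X]) (osc : Set (Fin 2 → ℝ))
    (hosc : ∀ p : Fin 2 → ℝ, p ∈ osc ↔ 0 < p 0 ∧ 0 < p 1 ∧ (P.map (evalRingHom (p 0))).IsRoot (p 1) ∧
      (Q.map (evalRingHom (p 0))).IsRoot (p 1))
    (hfin : osc.Finite) (hPQ : ∀ t : ℝ, P.map (evalRingHom t) = 0 → Q.map (evalRingHom t) = 0)
    (Pex : ℝ[X]) (hPex : Pex ≠ 0) (hroot : ∀ p ∈ osc, Pex.IsRoot (p 0)) :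
    osc.ncard ≤ P.natDegree * Pex.support.card := by
  classical
  -- no vertical fibre
  have hPt : ∀ p ∈ osc, P.map (evalRingHom (p 0)) ≠ 0 := by
    intro p hp h0
    obtain ⟨ht, -, -, -⟩ := (hosc p).1 hp
    apply hfin.not_infinite
    refine OsculationCuspGen.infinite_of_vertical (p 0) fun b hb => (hosc _).2 ⟨?_, ?_, ?_, ?_⟩
    · simpa using ht
    · simpa using hb
    · simp only [Matrix.cons_val_zero, Matrix.cons_val_one]; rw [h0]; exact IsRoot.def.2 (eval_zero)
    · simp only [Matrix.cons_val_zero, Matrix.cons_val_one]; rw [hPQ _ h0]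
      exact IsRoot.def.2 (eval_zero)
  set T : Finset ℝ := (Pex.roots.filter (fun t => 0 < t)).toFinset with hT
  set F : Finset (Fin 2 → ℝ) :=
    T.biUnion (fun t => ((P.map (evalRingHom t)).roots.toFinset).image (fun b => (![t, b] : Fin 2 → ℝ))) with hF
  have hsub : osc ⊆ ↑F := by
    intro p hp
    obtain ⟨ht, hb, hProot, -⟩ := (hosc p).1 hp
    rw [Finset.mem_coe, hF, Finset.mem_biUnion]
    refine ⟨p 0, ?_, ?_⟩
    · rw [hT, Multiset.mem_toFinset, Multiset.mem_filter]
      exact ⟨(mem_roots hPex).2 (hroot p hp), ht⟩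
    · rw [Finset.mem_image]
      exact ⟨p 1, by rw [Multiset.mem_toFinset]; exact (mem_roots (hPt p hp)).2 hProot, vec2_eq p⟩
  have hTcard : T.card ≤ Pex.support.card :=
    (Multiset.toFinset_card_le _).trans (OsculationRankOne.card_roots_filter_pos_le_card_support Pex)
  calc osc.ncard ≤ (↑F : Set (Fin 2 → ℝ)).ncard := Set.ncard_le_ncard hsub (Finset.finite_toSet F)
    _ = F.card := Set.ncard_coe_finset F
    _ ≤ ∑ t ∈ T, (((P.map (evalRingHom t)).roots.toFinset).image (fun b => (![t, b] : Fin 2 → ℝ))).card :=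
        Finset.card_biUnion_le
    _ ≤ ∑ _t ∈ T, P.natDegree := by
        refine Finset.sum_le_sum fun t _ => ?_
        refine Finset.card_image_le.trans ((Multiset.toFinset_card_le _).trans ?_)
        exact (card_roots' _).trans (natDegree_map_le)
    _ = T.card * P.natDegree := by rw [Finset.sum_const, smul_eq_mul]
    _ ≤ Pex.support.card * P.natDegree := Nat.mul_le_mul_right _ hTcard
    _ = P.natDegree * Pex.support.card := Nat.mul_comm _ _

/-! ### The gcd-row data from subresultants, in the two degree orders -/

/-- The gcd row of `OsculationUniform.gcd_row` for the ordered pair `(f, g)`, re-read for `(P, Q) = (f, g)` or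
`(g, f)`, with the exceptional polynomial `Pex = lc f · lc g · σ_k`. [folklore] -/
theorem row_data (P Q f g : ℝ[X][X]) (hfg : (f = P ∧ g = Q) ∨ (f = Q ∧ g = P)) {n m k : ℕ}
    (hn : f.natDegree = n) (hm : g.natDegree = m) (hmn : m ≤ n) (hkm : k ≤ m)
    (hlow : ∀ j < k, subresultant f g j = 0) :
    ∃ (N : ℝ[X][X]) (D : ℝ[X]), ∀ t : ℝ, 0 < t →
      (f.leadingCoeff * g.leadingCoeff * subresultant f g k).eval t ≠ 0 →
      D.eval t ≠ 0 ∧ (C (D.eval t)⁻¹ * N.map (evalRingHom t)).Monic ∧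
        C (D.eval t)⁻¹ * N.map (evalRingHom t) ∣ P.map (evalRingHom t) ∧
        (∀ β : ℝ, (P.map (evalRingHom t)).IsRoot β → (Q.map (evalRingHom t)).IsRoot β →
          (C (D.eval t)⁻¹ * N.map (evalRingHom t)).IsRoot β) ∧
        (∀ β : ℝ, (C (D.eval t)⁻¹ * N.map (evalRingHom t)).IsRoot β → (Q.map (evalRingHom t)).IsRoot β) := by
  obtain ⟨N, D, h⟩ := gcd_row f g hn hm hmn hkm hlow
  refine ⟨N, D, fun t _ hPex => ?_⟩
  rw [eval_mul, eval_mul] at hPex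
  have hlf : f.leadingCoeff.eval t ≠ 0 := fun h0 => hPex (by rw [h0, zero_mul, zero_mul])
  have hlg : g.leadingCoeff.eval t ≠ 0 := fun h0 => hPex (by rw [h0, mul_zero, zero_mul])
  have hσ : (subresultant f g k).eval t ≠ 0 := fun h0 => hPex (by rw [h0, mul_zero])
  obtain ⟨hD, hmon, hdf, hdg, hcommon⟩ := h t hlf hlg hσ
  rcases hfg with ⟨rfl, rfl⟩ | ⟨rfl, rfl⟩
  · exact ⟨hD, hmon, hdf, fun β hP hQ => hcommon β hP hQ, fun β hρ => hρ.dvd hdg⟩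
  · exact ⟨hD, hmon, hdg, fun β hP hQ => hcommon β hQ hP, fun β hρ => hρ.dvd hdf⟩

/-! ### The uniform count -/

/-- Sumsets of the empty alphabet: `w • ∅ = ∅` for `w ≥ 1`. [folklore] -/
theorem nsmul_empty (w : ℕ) (hw : 1 ≤ w) : w • (∅ : Finset ℕ) = ∅ := by
  obtain ⟨w, rfl⟩ : ∃ w', w = w' + 1 := ⟨w - 1, by omega⟩
  rw [succ_nsmul, Finset.add_empty]

/-- **THE UNIFORM COUNT.**  For isobaric fewnomial `P` (weight `α`, hyperbolic in `b` for `t > 0`) and `Q` (weight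
`β`) over the exponent alphabet `E`, with `P(t,·) ≡ 0 ⇒ Q(t,·) ≡ 0`, a finite set
`osc = {t > 0, b > 0, P = Q = 0}` has at most `α · |E| ^ ((α + β)² + (α + β))` points. -/
theorem uniform_count (E : Finset ℕ) (P Q : ℝ[X][X]) (α β : ℕ)
    (hP₁ : ∀ j, j ≤ α → (P.coeff j).support ⊆ (α - j) • E) (hP₂ : ∀ j, α < j → P.coeff j = 0)
    (hQ₁ : ∀ j, j ≤ β → (Q.coeff j).support ⊆ (β - j) • E) (hQ₂ : ∀ j, β < j → Q.coeff j = 0)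
    (hsplit : ∀ t : ℝ, 0 < t → (P.map (evalRingHom t)).Splits)
    (hPQ : ∀ t : ℝ, P.map (evalRingHom t) = 0 → Q.map (evalRingHom t) = 0)
    (osc : Set (Fin 2 → ℝ))
    (hosc : ∀ p : Fin 2 → ℝ, p ∈ osc ↔ 0 < p 0 ∧ 0 < p 1 ∧ (P.map (evalRingHom (p 0))).IsRoot (p 1) ∧
      (Q.map (evalRingHom (p 0))).IsRoot (p 1))
    (hfin : osc.Finite) :
    osc.ncard ≤ α * E.card ^ ((α + β) ^ 2 + (α + β)) := by
  classical
  have hnP : P.natDegree ≤ α := natDegree_le_of_isobaric P α hP₂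
  have hnQ : Q.natDegree ≤ β := natDegree_le_of_isobaric Q β hQ₂
  /- (0) `P = 0`: every point of the quadrant is in `osc`, which is then infinite. -/
  rcases eq_or_ne P 0 with hP0 | hP0
  · exfalso
    apply hfin.not_infinite
    refine OsculationCuspGen.infinite_of_vertical 1 fun b hb => (hosc _).2 ⟨?_, ?_, ?_, ?_⟩
    · simp
    · simpa using hb
    · simp only [Matrix.cons_val_zero, Matrix.cons_val_one, hP0, Polynomial.map_zero]
      exact IsRoot.def.2 (eval_zero)
    · simp only [Matrix.cons_val_zero, Matrix.cons_val_one]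
      rw [hPQ 1 (by rw [hP0, Polynomial.map_zero])]
      exact IsRoot.def.2 (eval_zero)
  /- (1) the empty alphabet: `P = C(c₀)·b^α` with `c₀ ≠ 0` has no positive zeros, `osc = ∅`. -/
  rcases Nat.eq_zero_or_pos E.card with hE0 | hEpos
  · have hE : E = ∅ := Finset.card_eq_zero.1 hE0
    have hcoeffP : ∀ j, j ≠ α → P.coeff j = 0 := by
      intro j hj
      rcases Nat.lt_or_ge α j with h | h
      · exact hP₂ j h
      · have hs := hP₁ j h
        rw [hE, nsmul_empty (α - j) (by omega)] at hs
        exact Polynomial.support_eq_empty.1 (Finset.subset_empty.1 hs)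
    have hsuppα : (P.coeff α).support ⊆ {0} := by
      have hs := hP₁ α le_rfl
      rwa [Nat.sub_self, zero_nsmul] at hs
    set c₀ : ℝ := (P.coeff α).coeff 0 with hc₀def
    have hcα : P.coeff α = C c₀ := by
      ext j
      rcases j with _ | j
      · rw [coeff_C_zero]
      · rw [coeff_C_succ]
        by_contra hne
        have := hsuppα (mem_support_iff.2 hne)
        simp at this
    have hc0 : c₀ ≠ 0 := by
      intro h0
      apply hP0
      ext j : 1
      rcases eq_or_ne j α with rfl | hj
      · rw [hcα, h0, map_zero, coeff_zero]
      · rw [hcoeffP j hj, coeff_zero]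
    have hempty : osc = ∅ := by
      ext p
      simp only [Set.mem_empty_iff_false, iff_false]
      intro hp
      obtain ⟨-, hb, hProot, -⟩ := (hosc p).1 hp
      have hval : (P.map (evalRingHom (p 0))).eval (p 1) = c₀ * p 1 ^ α := by
        have hPform : P = C (C c₀) * X ^ α := by
          ext j : 1
          rw [coeff_C_mul_X_pow]
          split_ifs with h
          · rw [h, hcα]
          · exact hcoeffP j h
        have e1 : (P.map (evalRingHom (p 0))).eval (p 1) =
            ((C (C c₀) * X ^ α : ℝ[X][X]).map (evalRingHom (p 0))).eval (p 1) := by rw [← hPform]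
        rw [e1, Polynomial.map_mul, Polynomial.map_pow, map_X, map_C, eval_mul, eval_pow, eval_X, eval_C,
          coe_evalRingHom, eval_C]
      have := hProot.eq_zero
      rw [hval] at this
      rcases mul_eq_zero.1 this with h | h
      · exact hc0 h
      · exact absurd (pow_eq_zero_iff'.1 h).1 hb.ne'
    rw [hempty, Set.ncard_empty]; exact Nat.zero_le _
  have hE1 : 1 ≤ E.card := hEpos
  /- (2) `Q = 0`: the row is `P(t,·)/lc P(t)` and `Pex = lc P`. -/
  rcases eq_or_ne Q 0 with hQ0 | hQ0
  · have hPex : P.leadingCoeff ≠ 0 := leadingCoeff_ne_zero.2 hP0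
    have hroots : ∀ p ∈ osc, P.leadingCoeff.IsRoot (p 0) := by
      refine abscissa_isRoot P Q osc hosc hfin hsplit P P.leadingCoeff P.leadingCoeff
        (fun t _ h => map_ne_zero_of_eval_leadingCoeff h) fun t _ h => ?_
      have hPt : P.map (evalRingHom t) ≠ 0 := map_ne_zero_of_eval_leadingCoeff h
      have hlu : lu (P.map (evalRingHom t)) = P.leadingCoeff.eval t := by
        rw [lu_of_ne_zero hPt, leadingCoeff_map_of_leadingCoeff_ne_zero (evalRingHom t) (by exact h)]; rfl
      have hnf : C (P.leadingCoeff.eval t)⁻¹ * P.map (evalRingHom t) = normalForm (P.map (evalRingHom t)) := by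
        rw [normalForm, hlu]
      refine ⟨h, by rw [hnf]; exact monic_normalForm hPt, ⟨C (P.leadingCoeff.eval t), ?_⟩, fun β hPβ _ => ?_,
        fun β _ => ?_⟩
      · rw [mul_comm, ← mul_assoc, ← C_mul, mul_inv_cancel₀ h, C_1, one_mul]
      · rw [IsRoot, eval_mul, hPβ.eq_zero, mul_zero]
      · rw [hQ0, Polynomial.map_zero]; exact IsRoot.def.2 (eval_zero)
    refine (ncard_le_of_abscissa_isRoot P Q osc hosc hfin hPQ _ hPex hroots).trans ?_
    refine Nat.mul_le_mul hnP ?_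
    refine (OsculationCusp.card_support_le_of_subset_nsmul (supp_leadingCoeff_isobaric E P α hP₁ hP₂)).trans ?_
    exact Nat.pow_le_pow_right hE1 (by nlinarith [Nat.sub_le α P.natDegree])
  /- (3) the generic case: subresultants of the pair ordered by `b`-degree. -/
  -- choose the order
  obtain ⟨f, g, hfg, hmn⟩ : ∃ f g : ℝ[X][X], ((f = P ∧ g = Q) ∨ (f = Q ∧ g = P)) ∧ g.natDegree ≤ f.natDegree := by
    rcases le_total Q.natDegree P.natDegree with h | h
    · exact ⟨P, Q, Or.inl ⟨rfl, rfl⟩, h⟩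
    · exact ⟨Q, P, Or.inr ⟨rfl, rfl⟩, h⟩
  have hf0 : f ≠ 0 := by rcases hfg with ⟨rfl, -⟩ | ⟨rfl, -⟩ <;> assumption
  have hg0 : g ≠ 0 := by rcases hfg with ⟨-, rfl⟩ | ⟨-, rfl⟩ <;> assumption
  -- isobaric data of `f` and `g`
  obtain ⟨αf, αg, hf₁, hf₂, hg₁, hg₂, hsum⟩ : ∃ αf αg : ℕ,
      (∀ j, j ≤ αf → (f.coeff j).support ⊆ (αf - j) • E) ∧ (∀ j, αf < j → f.coeff j = 0) ∧
      (∀ j, j ≤ αg → (g.coeff j).support ⊆ (αg - j) • E) ∧ (∀ j, αg < j → g.coeff j = 0) ∧ αf + αg = α + β := by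
    rcases hfg with ⟨rfl, rfl⟩ | ⟨rfl, rfl⟩
    · exact ⟨α, β, hP₁, hP₂, hQ₁, hQ₂, rfl⟩
    · exact ⟨β, α, hQ₁, hQ₂, hP₁, hP₂, Nat.add_comm β α⟩
  have hnf : f.natDegree ≤ αf := natDegree_le_of_isobaric f αf hf₂
  have hng : g.natDegree ≤ αg := natDegree_le_of_isobaric g αg hg₂
  -- the least index with a non-vanishing subresultant
  have hex : ∃ k, subresultant f g k ≠ 0 :=
    ⟨g.natDegree, by rw [subresultant_natDegree_right]; exact pow_ne_zero _ (leadingCoeff_ne_zero.2 hg0)⟩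
  set k := Nat.find hex with hk
  have hσk : subresultant f g k ≠ 0 := Nat.find_spec hex
  have hkm : k ≤ g.natDegree := Nat.find_le (by
    rw [subresultant_natDegree_right]; exact pow_ne_zero _ (leadingCoeff_ne_zero.2 hg0))
  have hlow : ∀ j < k, subresultant f g j = 0 := fun j hj => by
    by_contra hne; exact Nat.find_min hex hj hne
  -- the exceptional polynomial
  set Pex : ℝ[X] := f.leadingCoeff * g.leadingCoeff * subresultant f g k with hPexdef
  have hPex : Pex ≠ 0 := mul_ne_zero (mul_ne_zero (leadingCoeff_ne_zero.2 hf0) (leadingCoeff_ne_zero.2 hg0)) hσk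
  obtain ⟨N, D, hrow⟩ := row_data P Q f g hfg rfl rfl hmn hkm hlow
  have hPne : ∀ t : ℝ, 0 < t → Pex.eval t ≠ 0 → P.map (evalRingHom t) ≠ 0 := by
    intro t _ hPext
    apply map_ne_zero_of_eval_leadingCoeff
    rw [hPexdef, eval_mul, eval_mul] at hPext
    rcases hfg with ⟨rfl, -⟩ | ⟨-, rfl⟩
    · exact fun h0 => hPext (by rw [h0, zero_mul, zero_mul])
    · exact fun h0 => hPext (by rw [h0, mul_zero, zero_mul])
  have hroots := abscissa_isRoot P Q osc hosc hfin hsplit N D Pex hPne hrow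
  refine (ncard_le_of_abscissa_isRoot P Q osc hosc hfin hPQ Pex hPex hroots).trans (Nat.mul_le_mul hnP ?_)
  -- the monomial count of `Pex`
  obtain ⟨W, hW, hsW⟩ := supp_subresultant E f g αf αg hf₁ hf₂ hg₁ hg₂ k
  have hsPex : Pex.support ⊆ ((αf - f.natDegree) + (αg - g.natDegree) + W) • E :=
    OsculationCusp.supp_mul (OsculationCusp.supp_mul (supp_leadingCoeff_isobaric E f αf hf₁ hf₂)
      (supp_leadingCoeff_isobaric E g αg hg₁ hg₂)) hsW
  refine (OsculationCusp.card_support_le_of_subset_nsmul hsPex).trans (Nat.pow_le_pow_right hE1 ?_)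
  have h1 : W ≤ (αf + αg) ^ 2 := by
    refine hW.trans ?_
    nlinarith [hnf, hng, Nat.zero_le αf, Nat.zero_le αg, Nat.zero_le f.natDegree, Nat.zero_le g.natDegree]
  have h2 : αf - f.natDegree + (αg - g.natDegree) ≤ αf + αg := by omega
  rw [← hsum]
  omega

end OsculationUniform

end Summit.ValiantsHypothesis.ValiantsHypothesis.Theorems.LacunarySymmetroidMatrixDescartes
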